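import Summits.SmoothPoincare4.SmoothPoincare4.Theses.RootDecompAD
import Literature.Topology.FourManifolds.CappellShanesonTraceSymmetry
import HarnessLib

/-!
# RootDecompAD — glue of the rev-2 split «SymmetryWindow» of `CSStandard`

Proves the glue item `CSStandardGlue` (stmt-SmoothPoincare4-32671, support, rank 205) of route-SmoothPoincare4-RootDecompAD rev 2:
`TransposeClosure → WindowOrbitStandard → DualClosure → TailOrbitStandard → CSStandard`
(stmt-SmoothPoincare4-32667 → 32668 → 32669 → 32670 → 31396; binder order = the gate-rendered children order).
Ten lines of logic plus `(Aᵀ)ᵀ = A` and the Kim–Yamada identities `det (A* − 1) = 1`, `(A*)* = A` (tree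
`Literature.Topology.FourManifolds.det_coe_csDual_sub_one`, `csDual_csDual`, module CappellShanesonTraceSymmetry).
Text = writer g4 landing file HOME/decomp-sp4-writer-1/g4/adglue/RootDecompADCSStandardSplit.lean (sha256 0d218e94…; farm rc 0,
axioms standard; re-checked by census-trib-sp4-8, TRIB-SP4-ROOTDECOMP-8.md §Method) moved from the route namespace into a Theorems
namespace (tactic script byte-identical). Root decomposition cell decomp-sp4 (D-0178); 0 sorry. Nothing here proves `SmoothPoincare4`.
-/

set_option linter.dupNamespace false

namespace Summit.SmoothPoincare4.SmoothPoincare4.Theorems.RootDecompADCSStandardSplit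

open Summit.SmoothPoincare4.SmoothPoincare4.Theses.RootDecompAD

/-- Item stmt-SmoothPoincare4-32671: the symmetry-window cells (transpose closure, window, dual closure, tail) re-assemble `CSStandard`. -/
theorem csStandardGlue_holds : CSStandardGlue := by
  intro hT hW hD hTail X _ _ _ _ _ _ hX  -- binder order = the GATE-RENDERED glue (children order): TC → W → DC → T → CSStandard
  obtain ⟨A, hA⟩ := hX
  rcases (Classical.em _).elim (fun hw => hW A hw) (fun hw => hTail A hA.det_sub_one hw) with h | h | ⟨hdet, B, hB, h⟩
  · exact h X hA
  · -- `Std Aᵀ ⇒ Std A`: TransposeClosure on `Aᵀ`, `(Aᵀ)ᵀ = A`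
    have h' := hT _ h
    rw [show Matrix.SpecialLinearGroup.transpose (Matrix.SpecialLinearGroup.transpose A) = A from
      Subtype.ext (Matrix.transpose_transpose _)] at h'
    exact h' X hA
  · -- `Std A* ⇒ Std A`: DualClosure on `B = A*`, with `det (A* − 1) = 1` and `(A*)* = A` (Kim–Yamada Lemma 3.6; tree `csDual_csDual`)
    have hBeq : B = Literature.Topology.FourManifolds.csDual A := by
      rw [Matrix.SpecialLinearGroup.ext_iff]
      intro i j
      rw [Literature.Topology.FourManifolds.coe_csDual hdet, Literature.Topology.FourManifolds.csDualMatrix, hB]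
    have hBdet : ((B : Matrix (Fin 3) (Fin 3) ℤ) - 1).det = 1 := by
      rw [hBeq]; exact Literature.Topology.FourManifolds.det_coe_csDual_sub_one hdet
    have hAB : (A : Matrix (Fin 3) (Fin 3) ℤ) = (B : Matrix (Fin 3) (Fin 3) ℤ) * (B : Matrix (Fin 3) (Fin 3) ℤ) +
        (1 - Matrix.trace (B : Matrix (Fin 3) (Fin 3) ℤ)) • (B : Matrix (Fin 3) (Fin 3) ℤ) + 1 := by
      have e : Literature.Topology.FourManifolds.csDual B = A := by
        rw [hBeq]; exact Literature.Topology.FourManifolds.csDual_csDual hdet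
      rw [← Literature.Topology.FourManifolds.csDualMatrix, ← Literature.Topology.FourManifolds.coe_csDual hBdet, e]
    exact hD B A hBdet hAB h X hA

end Summit.SmoothPoincare4.SmoothPoincare4.Theorems.RootDecompADCSStandardSplit
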